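import Mathlib

/-!
# Klein-bottle groups of the spun trefoil: the principal classes collapse to `ℤ/2`

Kernel certificate for Proposition 11.10(ii) of the solo-informed notes (attempt A82, claim C100).

The fundamental group of the complement of the Klein bottle `Kb_{[w],f} ⊂ S⁴` (the `c`-spun trefoil
Klein bottle, surgered along a section in the twisted class `[w]`) has the presentation
`⟨x, y | x² = y³, w⁻¹ x w = x⁻¹, w⁻¹ y w = y⁻¹⟩` ("conjugation by `w` is the inversion
automorphism").  We certify the purely group-theoretic collapse: in ANY group, if `x ^ 2 = y ^ 3`,
conjugation by `w` inverts `x` and `y`, and `w` commutes with the meridian `x⁻¹ * y`, then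
`y = 1` and `x ^ 2 = 1`, so the subgroup generated by `x, y` is `{1, x}`.  This applies to every
`w = (x⁻¹ y)^k` and `w = x² (x⁻¹ y)^k` (`k : ℤ`), i.e. to all "principal" twisted classes of every
trace `k`.  A model in `Multiplicative (ZMod 2)` shows the quotient really has order two.
No topology is formalised here.
-/

namespace Summit.SmoothPoincare4.SmoothPoincare4.Theorems.KleinBottleGroup

/-- Core collapse: `x² = y³`, `w` inverts `x` and `y` by conjugation, and `w` commutes with
`x⁻¹ y`; then `y = 1` and `x² = 1`.  (Proof: `w⁻¹ (x⁻¹y) w` equals both `x⁻¹y` and `x y⁻¹`,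
hence `y = x² y⁻¹`, so `y² = x² = y³`.) -/
theorem collapse {G : Type*} [Group G] {x y w : G} (h0 : x ^ 2 = y ^ 3)
    (hc : Commute w (x⁻¹ * y)) (hx : w⁻¹ * x * w = x⁻¹) (hy : w⁻¹ * y * w = y⁻¹) :
    y = 1 ∧ x ^ 2 = 1 := by
  have h1 : w⁻¹ * (x⁻¹ * y) * w = x * y⁻¹ := by
    have : w⁻¹ * (x⁻¹ * y) * w = (w⁻¹ * x * w)⁻¹ * (w⁻¹ * y * w) := by group
    rw [this, hx, hy, inv_inv]
  have h2 : w⁻¹ * (x⁻¹ * y) * w = x⁻¹ * y := by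
    have hce : w * (x⁻¹ * y) = x⁻¹ * y * w := hc.eq
    calc w⁻¹ * (x⁻¹ * y) * w = w⁻¹ * (x⁻¹ * y * w) := by group
      _ = w⁻¹ * (w * (x⁻¹ * y)) := by rw [hce]
      _ = x⁻¹ * y := by group
  have h3 : x⁻¹ * y = x * y⁻¹ := h2.symm.trans h1
  have h4 : y * y = x ^ 2 := by
    have hyx : y = x * (x * y⁻¹) := by
      calc y = x * (x⁻¹ * y) := by group
        _ = x * (x * y⁻¹) := by rw [h3]
    calc y * y = x * (x * y⁻¹) * y := by rw [← hyx]
      _ = x * x := by group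
      _ = x ^ 2 := (pow_two x).symm
  have h5 : y * y = y * y * y := by
    calc y * y = x ^ 2 := h4
      _ = y ^ 3 := h0
      _ = y * y * y := by rw [pow_succ, pow_two]
  have hy1 : y = 1 := by
    have : (1 : G) = y := by
      calc (1 : G) = (y * y)⁻¹ * (y * y) := by group
        _ = (y * y)⁻¹ * (y * y * y) := by rw [← h5]
        _ = y := by group
    exact this.symm
  refine ⟨hy1, ?_⟩
  rw [h0, hy1, one_pow]

/-- Under the hypotheses of `collapse`, `x` is an involution: `x⁻¹ = x`. -/
theorem inv_eq_self_of_collapse {G : Type*} [Group G] {x y w : G} (h0 : x ^ 2 = y ^ 3)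
    (hc : Commute w (x⁻¹ * y)) (hx : w⁻¹ * x * w = x⁻¹) (hy : w⁻¹ * y * w = y⁻¹) :
    x⁻¹ = x := by
  have h := (collapse h0 hc hx hy).2
  have : x * x = 1 := by rw [← pow_two]; exact h
  calc x⁻¹ = x⁻¹ * (x * x) := by rw [this, mul_one]
    _ = x := by group

/-- Principal classes of trace `k`: `w = (x⁻¹ y)^k` commutes with the meridian, so the
Klein-bottle relations force `y = 1 ∧ x² = 1` for every `k : ℤ`. -/
theorem collapse_meridian_zpow {G : Type*} [Group G] {x y : G} (k : ℤ) (h0 : x ^ 2 = y ^ 3)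
    (hx : ((x⁻¹ * y) ^ k)⁻¹ * x * (x⁻¹ * y) ^ k = x⁻¹)
    (hy : ((x⁻¹ * y) ^ k)⁻¹ * y * (x⁻¹ * y) ^ k = y⁻¹) : y = 1 ∧ x ^ 2 = 1 :=
  collapse h0 ((Commute.refl (x⁻¹ * y)).zpow_left k) hx hy

/-- The `z`-partners `w = x² (x⁻¹ y)^k` (the classes `-[[k,1],[1,0]]`): `x² = y³` is central in
`⟨x, y⟩`, so `w` again commutes with the meridian and the group collapses. -/
theorem collapse_central_meridian_zpow {G : Type*} [Group G] {x y : G} (k : ℤ)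
    (h0 : x ^ 2 = y ^ 3)
    (hx : (x ^ 2 * (x⁻¹ * y) ^ k)⁻¹ * x * (x ^ 2 * (x⁻¹ * y) ^ k) = x⁻¹)
    (hy : (x ^ 2 * (x⁻¹ * y) ^ k)⁻¹ * y * (x ^ 2 * (x⁻¹ * y) ^ k) = y⁻¹) :
    y = 1 ∧ x ^ 2 = 1 := by
  have hzx : Commute (x ^ 2) x⁻¹ := (Commute.pow_self x 2).inv_right
  have hzy : Commute (x ^ 2) y := by rw [h0]; exact Commute.pow_self y 3
  have hz : Commute (x ^ 2) (x⁻¹ * y) := hzx.mul_right hzy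
  have hc : Commute (x ^ 2 * (x⁻¹ * y) ^ k) (x⁻¹ * y) :=
    hz.mul_left ((Commute.refl (x⁻¹ * y)).zpow_left k)
  exact collapse h0 hc hx hy

/-- If `x ^ 2 = 1`, every element of the cyclic subgroup generated by `x` is `1` or `x`. -/
theorem eq_one_or_eq_of_mem_zpowers {G : Type*} [Group G] {x g : G} (hx2 : x ^ 2 = 1)
    (hg : g ∈ Subgroup.zpowers x) : g = 1 ∨ g = x := by
  obtain ⟨k, rfl⟩ := Subgroup.mem_zpowers_iff.mp hg
  have h2 : x ^ (2 : ℤ) = 1 := by exact_mod_cast hx2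
  rcases Int.even_or_odd k with ⟨j, hj⟩ | ⟨j, hj⟩
  · left
    rw [hj, ← two_mul, zpow_mul, h2, one_zpow]
  · right
    rw [hj, zpow_add, zpow_mul, h2, one_zpow, one_mul, zpow_one]

/-- Conclusion for the Klein-bottle group: under the hypotheses of `collapse` the subgroup
generated by `x` and `y` is the cyclic subgroup generated by `x`, and consists of `1` and `x`
only.  (Applied with `G = Q_w` generated by `x, y`, this says `|Q_w| ≤ 2`.) -/
theorem closure_pair_subset {G : Type*} [Group G] {x y w : G} (h0 : x ^ 2 = y ^ 3)
    (hc : Commute w (x⁻¹ * y)) (hx : w⁻¹ * x * w = x⁻¹) (hy : w⁻¹ * y * w = y⁻¹)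
    {g : G} (hg : g ∈ Subgroup.closure ({x, y} : Set G)) : g = 1 ∨ g = x := by
  obtain ⟨hy1, hx2⟩ := collapse h0 hc hx hy
  have hle : Subgroup.closure ({x, y} : Set G) ≤ Subgroup.zpowers x := by
    rw [Subgroup.closure_le]
    intro s hs
    simp only [Set.mem_insert_iff, Set.mem_singleton_iff] at hs
    rcases hs with rfl | rfl
    · exact Subgroup.mem_zpowers s
    · rw [hy1]; exact one_mem _
  exact eq_one_or_eq_of_mem_zpowers hx2 (hle hg)

/-- The order-two quotient exists: in `Multiplicative (ZMod 2)` the assignment `x ↦` generator,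
`y ↦ 1`, `w ↦ x` satisfies all relations (`x² = y³`, `w` inverts `x` and `y`, `w` commutes with
`x⁻¹ y`) with `x ≠ 1`.  Hence the Klein-bottle groups of the principal classes are exactly `ℤ/2`. -/
theorem model_zmod_two :
    let x : Multiplicative (ZMod 2) := Multiplicative.ofAdd 1
    let y : Multiplicative (ZMod 2) := 1
    let w : Multiplicative (ZMod 2) := Multiplicative.ofAdd 1
    x ^ 2 = y ^ 3 ∧ w⁻¹ * x * w = x⁻¹ ∧ w⁻¹ * y * w = y⁻¹ ∧ w * (x⁻¹ * y) = x⁻¹ * y * w ∧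
      x ≠ 1 := by
  decide

end Summit.SmoothPoincare4.SmoothPoincare4.Theorems.KleinBottleGroup
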